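import Summits.QuantumFields.BalabanUV.Beta.FP.TorusCombNestedBasis

/-!
# `BalabanUV.Beta.FP.CombSlicePathInverse` — road «FP» for binder row D1, ROUTE T, TID-LETTER-SPEC § B (iii)∕(v): **THE INVERSE OF THE ONE-SHOT
# FADDEEV–POPOV OPERATOR `P·W₀` IN CLOSED FORM** — for a ranked rooted forest the signed reduced incidence matrix
# `M x s = ε x · ([s = x] − [parent x = s])` (`TorusCombRows.combRowsT_mul_entry`: `combRowsT · D↾Res` for ANY `D` reading the lattice gradient on the comb
# bonds) has inverse **`M⁻¹ y x = ε x · [x is an ancestor-or-self of y]`** (`Relation.ReflTransGen` of «`parent · = some ·`»), i.e. column `x` of `(P·W₀)⁻¹`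
# in the comb's own basis is the SIGNED INDICATOR OF THE SUBTREE BELOW `x`; at the torus call's literal (`P` = the BIG comb re-indexed by
# `TorusCombNestedBasis.resBigEquiv` on the field slots, `W₀ = [tgradBlock↾Res′ | tgrad↾Res]`) the factorisation `P·W₀ = T″∘(e.symm, e.symm) · C`
# (`W0_eq`, `C = evalC = fromBlocks 1 0 E 1`) gives **`(P·W₀)⁻¹ = fromBlocks 1 0 (−E) 1 · (T″⁻¹)∘(e.symm, e.symm)`** with `T″⁻¹` as displayed — the
# column `e x` that `CombSliceRowJets`' «`d₂ − d₁²`» contracts against the dictionary's row-ultralocal generator jets `W₁ b`, `W₂ b`.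

HONEST DEPENDENCY (page 1, mandatory): continuum YM on T⁴ ⇐ BetaPertH ∧ nine spine estimates (0/9 proved); BetaPertH ⇐ (D1) ∧ (D4) ∧ CAP+tail;
G-an2-4 gates asym, D1 and NE2/3/4.  HONEST FRAMING (cell contract, verbatim): «discharging `BetaPertH` makes Bałaban's UV stability UNCONDITIONAL —
a real constructive-QFT result; it is NOT the continuum limit and NOT the Clay problem.»  ABSOLUTE RULE (cell charter, verbatim): «No internally-minted
statement may enter as a cited fact. Every hypothesis is either kernel-proved in this package or a verbatim quotation of a PUBLISHED theorem with page
reference. The manuscript(s) under audit are NOT citable for their own disputed steps — they are the thing under adjudication; programme-internal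
(2001/route/tribunal) claims are never citable.»  THIS MODULE is [folklore] finite linear algebra of rooted forests (`Matrix.inv_eq_right_inv`, `Matrix.mul_inv_rev`,
`Matrix.inv_submatrix_equiv`, `Matrix.fromBlocks_multiply`, `Relation.ReflTransGen.cases_head_iff`) over `FP/TorusCombForest` ∕ `FP/TorusCombRows` ∕
`FP/TorusCombNestedBasis`; no `def`, no `def … : Prop`, nothing cited, 0 sorry; 0 estimates; 0∕4 row-D1 binders.  NOT the contraction with the dictionary's
`W₁^{(b)}` (leaf-02 `PeriodisedBorderWardContactInstance`, staged) — that is one `Finset.sum` away once it lands; NOT (T-ID), NOT SDF, NOT D1, NOT BetaPertH,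
NOT continuum, NOT Clay.  «not in print; our bookkeeping».

CONTENT.
* §1 generic ranked forest (`σ` finite, `rk`, `parent` with `hrk : parent x = some p → rk p < rk x`, signs `|ε x| = 1`): `rk_le_of_reflTransGen`,
  `not_reflTransGen_of_parent` (the parent of `x` is not below `x`), **`inv_of_gradientRows`** (`M⁻¹ = of (fun y x ↦ ε x · [ReflTransGen parent y x])`) and its
  entry form.
* §2 the torus comb (`0 < N`, `0 ≤ ρ < N`, `N ∣ M`): **`inv_combRowsT_mul_gradient`** (any `D` with the `hD` letter of `TorusCombRows`) and
  **`inv_combRowsT_mul_tgrad`** (`D := tgrad M`): `(combRowsT·tgrad↾Res)⁻¹ y x = signOf x · [x ancestor-or-self of y in the comb]`.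
* §3 at the torus call's literal: `evalC_mul_inv` ∕ `inv_evalC` (`C⁻¹ = fromBlocks 1 0 (−E) 1`), **`bigComb_PW0_eq`** (`P·[D₂|D₁] = T″∘(e.symm,e.symm) · C` on the
  field slots, `TorusCombNestedBasis` §5's typing `fun t => t.1`), **`inv_bigComb_PW0`**, and the two row-block entry formulas `inv_bigComb_PW0_apply_inl`
  (`(P·W₀)⁻¹ (inl t̄) (e x) = T″⁻¹ (e.symm (inl t̄)) x` — the small root of block `t̄` against `x`) ∕ `inv_bigComb_PW0_apply_inr`
  (`(P·W₀)⁻¹ (inr s) (e x) = T″⁻¹ (e.symm (inr s)) x − Σ_{t̄} E s t̄ · T″⁻¹ (e.symm (inl t̄)) x`).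
Provenance: D1 formalisation swarm LEAF PROVER 06, unit b2b-balaban-beta-d1-formalise-leaf-06 gen 17, 2026-08-22 (companion of `CombSliceRowJets`; OWNER A1 to
I-FP-17-8: the per-dead-bond scalar `d₁ = W₁ b ⬝ᵥ ((P·W₀)⁻¹ ▸ column e x)` is the (T-ID)∕(UNI) residual).  No existing file touched.
-/

noncomputable section

namespace Summit.QuantumFields.BalabanUV.Beta.FP.CombSlicePathInverse

open Finset Matrix
open Literature.MathematicalPhysics.QuantumFieldTheory.Balaban1983to89
open Literature.MathematicalPhysics.QuantumFieldTheory.Balaban1983to89.Beta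
open B5Prop11Plancherel (fine)
open AffineAveraging (Site)
open B6Lemma24Torus (pbox)
open OneStepResolventKernel (Fib)
open Summit.QuantumFields.BalabanUV.Beta.FP.KernelPeriodisationFib (Idx)
open Summit.QuantumFields.BalabanUV.Beta.FP.TorusCombForest (depth signOf)
open Summit.QuantumFields.BalabanUV.Beta.FP.TorusCombRows (Res combBondT combRowsT parentT combRowsT_mul_entry depth_parentT tgrad_combBondT)
open Summit.QuantumFields.BalabanUV.Beta.FP.TorusGaugeCovariance (tgrad)
open Summit.QuantumFields.BalabanUV.Beta.FP.TorusGaugeCovarianceCoarse (tgradBlock)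
open Summit.QuantumFields.BalabanUV.Beta.FP.TorusCombNestedBasis (resBigEquiv evalE evalC bigRoot_bounds fine_dvd W0_eq submatrix_mul_submatrix
  combRowsT_fieldSlot_mul fromCols_submatrix_fieldSlot)

variable {d : ℕ}

/-! ## §1 Generic: the inverse of the signed reduced incidence matrix of a ranked forest -/

section Forest

variable {σ : Type*}

/-- [folklore] the rank decreases weakly along «parent» chains. -/
theorem rk_le_of_reflTransGen (rk : σ → ℕ) (parent : σ → Option σ) (hrk : ∀ x p, parent x = some p → rk p < rk x) {y z : σ}
    (h : Relation.ReflTransGen (fun a b => parent a = some b) y z) : rk z ≤ rk y := by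
  induction h with
  | refl => exact le_rfl
  | tail _ hbc ih => exact (hrk _ _ hbc).le.trans ih

/-- [folklore] the parent of `x` is not an element of the subtree below `x` (no «parent» chain leads from `parent x` back to `x`). -/
theorem not_reflTransGen_of_parent (rk : σ → ℕ) (parent : σ → Option σ) (hrk : ∀ x p, parent x = some p → rk p < rk x) {x p : σ}
    (hp : parent x = some p) : ¬ Relation.ReflTransGen (fun a b => parent a = some b) p x :=
  fun h => absurd (rk_le_of_reflTransGen rk parent hrk h) (not_le.2 (hrk x p hp))

/-- [folklore] a sign squares to one. -/
theorem sign_mul_self {ε : ℝ} (h : |ε| = 1) : ε * ε = 1 := by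
  rw [← abs_mul_abs_self, h, one_mul]

variable [Fintype σ] [DecidableEq σ]

open Classical in
/-- [folklore] **THE INVERSE OF THE SIGNED REDUCED INCIDENCE MATRIX OF A RANKED FOREST IS THE SIGNED ANCESTOR INDICATOR**: if
`M x s = ε x · ([s = x] − [parent x = s])` with `|ε| = 1` and ranks decreasing strictly to the parent, then
`M⁻¹ = of (fun y x ↦ ε x · [x is an ancestor-or-self of y])`. -/
theorem inv_of_gradientRows (M : Matrix σ σ ℝ) (rk : σ → ℕ) (parent : σ → Option σ) (hrk : ∀ x p, parent x = some p → rk p < rk x)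
    (ε : σ → ℝ) (hε : ∀ x, |ε x| = 1) (hM : ∀ x s, M x s = ε x * ((if s = x then 1 else 0) - (if parent x = some s then 1 else 0))) :
    M⁻¹ = Matrix.of fun y x => ε x * (if Relation.ReflTransGen (fun a b => parent a = some b) y x then 1 else 0) := by
  apply Matrix.inv_eq_right_inv
  ext y x
  rw [Matrix.mul_apply, Matrix.one_apply]
  rcases hpar : parent y with _ | p
  · -- `y` hangs from a root: row `y` of `M` is `ε y · e_y`
    have hrow : ∀ s, M y s = if s = y then ε y else 0 := by
      intro s; rw [hM, hpar]; split_ifs <;> simp_all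
    simp_rw [hrow, ite_mul, zero_mul, Finset.sum_ite_eq', Finset.mem_univ, if_true, Matrix.of_apply]
    have hiff : Relation.ReflTransGen (fun a b => parent a = some b) y x ↔ y = x := by
      rw [Relation.ReflTransGen.cases_head_iff]
      constructor
      · rintro (h | ⟨c, hc, _⟩)
        · exact h
        · rw [hpar] at hc; exact absurd hc (by simp)
      · exact fun h => Or.inl h
    simp only [hiff]
    by_cases hyx : y = x
    · subst hyx; rw [if_pos rfl, mul_one, sign_mul_self (hε y)]
    · rw [if_neg hyx, mul_zero, mul_zero]
  · -- `y` has the parent `p`: row `y` of `M` is `ε y · (e_y − e_p)`, `p ≠ y`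
    have hpy : p ≠ y := fun h => lt_irrefl _ (h ▸ hrk y p hpar)
    have hrow : ∀ s, M y s = (if s = y then ε y else 0) - (if s = p then ε y else 0) := by
      intro s; rw [hM, hpar]
      have e1 : (if some p = some s then (1 : ℝ) else 0) = if s = p then 1 else 0 := by
        by_cases h : s = p
        · subst h; rw [if_pos rfl, if_pos rfl]
        · rw [if_neg h, if_neg (fun h' => h (Option.some.inj h').symm)]
      rw [e1]
      split_ifs <;> ring
    simp_rw [hrow, sub_mul, Finset.sum_sub_distrib, ite_mul, zero_mul, Finset.sum_ite_eq', Finset.mem_univ, if_true, Matrix.of_apply]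
    have hiff : Relation.ReflTransGen (fun a b => parent a = some b) y x ↔ y = x ∨ Relation.ReflTransGen (fun a b => parent a = some b) p x := by
      rw [Relation.ReflTransGen.cases_head_iff]
      constructor
      · rintro (h | ⟨c, hc, hcx⟩)
        · exact Or.inl h
        · rw [hpar, Option.some.injEq] at hc; subst hc; exact Or.inr hcx
      · rintro (h | h)
        · exact Or.inl h
        · exact Or.inr ⟨p, hpar, h⟩
    by_cases hyx : y = x
    · subst hyx
      have hnp : ¬ Relation.ReflTransGen (fun a b => parent a = some b) p y := not_reflTransGen_of_parent rk parent hrk hpar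
      rw [if_pos Relation.ReflTransGen.refl, if_neg hnp, if_pos rfl, mul_one, mul_zero, mul_zero, sub_zero, sign_mul_self (hε y)]
    · have hiff' : Relation.ReflTransGen (fun a b => parent a = some b) y x ↔ Relation.ReflTransGen (fun a b => parent a = some b) p x := by
        rw [hiff]; exact ⟨fun h => h.resolve_left hyx, Or.inr⟩
      simp only [hiff', if_neg hyx, sub_self]

open Classical in
/-- [folklore] entry form of `inv_of_gradientRows`. -/
theorem inv_apply_of_gradientRows (M : Matrix σ σ ℝ) (rk : σ → ℕ) (parent : σ → Option σ) (hrk : ∀ x p, parent x = some p → rk p < rk x)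
    (ε : σ → ℝ) (hε : ∀ x, |ε x| = 1) (hM : ∀ x s, M x s = ε x * ((if s = x then 1 else 0) - (if parent x = some s then 1 else 0))) (y x : σ) :
    M⁻¹ y x = ε x * (if Relation.ReflTransGen (fun a b => parent a = some b) y x then 1 else 0) := by
  rw [inv_of_gradientRows M rk parent hrk ε hε hM, Matrix.of_apply]

end Forest

/-! ## §2 The torus comb: `(combRowsT · D↾Res)⁻¹` is the signed comb-ancestor indicator -/

section Comb

variable {N : ℕ} {ρ : Site (d + 1)} {M : Fin (d + 1) → ℕ}

/-- [folklore] the orientation signs of the comb forest square to one. -/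
theorem abs_signOf_cast (x : Res ρ N M) : |((signOf ρ N x.site : ℤ) : ℝ)| = 1 := by
  unfold signOf; split_ifs <;> simp

open Classical in
/-- [folklore] **`(combRowsT ρ N M · D↾Res)⁻¹ y x = signOf x · [x is a comb-ancestor-or-self of y]`** for every generator matrix `D` reading the lattice gradient on
the comb bonds (the `hD` letter of `TorusCombRows.combRowsT_mul_entry`). -/
theorem inv_combRowsT_mul_gradient (hN : 0 < N) (hρ : ∀ i, 0 ≤ ρ i ∧ ρ i < N) (hM : ∀ i, N ∣ M i) (D : Matrix (Idx M (Fib d)) ↥(pbox M) ℝ)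
    (hD : ∀ (x : Res ρ N M) (s : ↥(pbox M)),
      D (combBondT ρ N M x) s = (if TorusCombForest.tipOf ρ N x.site = (s : Site (d + 1)) then 1 else 0)
        - (if TorusCombForest.baseOf ρ N x.site = (s : Site (d + 1)) then 1 else 0)) :
    (combRowsT ρ N M * D.submatrix id (fun s : Res ρ N M => s.1))⁻¹
      = Matrix.of fun y x : Res ρ N M =>
          ((signOf ρ N x.site : ℤ) : ℝ) * (if Relation.ReflTransGen (fun a b => parentT ρ N M a = some b) y x then 1 else 0) :=
  inv_of_gradientRows _ (fun x => depth ρ N x.site) (parentT ρ N M) (fun x p h => depth_parentT hN hρ hM x p h)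
    (fun x => ((signOf ρ N x.site : ℤ) : ℝ)) abs_signOf_cast (combRowsT_mul_entry hN hρ hM D hD)

open Classical in
/-- [folklore] **AT gan24-leaf-05's TORUS GRADIENT COLUMNS**: `(combRowsT ρ N M · tgrad M↾Res)⁻¹ y x = signOf x · [x is a comb-ancestor-or-self of y]`. -/
theorem inv_combRowsT_mul_tgrad (hN : 0 < N) (hρ : ∀ i, 0 ≤ ρ i ∧ ρ i < N) (hM : ∀ i, N ∣ M i) :
    (combRowsT ρ N M * (tgrad M).submatrix id (fun s : Res ρ N M => s.1))⁻¹
      = Matrix.of fun y x : Res ρ N M =>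
          ((signOf ρ N x.site : ℤ) : ℝ) * (if Relation.ReflTransGen (fun a b => parentT ρ N M a = some b) y x then 1 else 0) :=
  inv_combRowsT_mul_gradient hN hρ hM (tgrad M) (tgrad_combBondT hN hρ hM)

end Comb

/-! ## §3 At the torus call's literal: `(P·[D₂|D₁])⁻¹ = C⁻¹ · (T″⁻¹)∘(e.symm, e.symm)` -/

section Torus

variable {N N₂ : ℕ} {ρ ρ₂ : Site (d + 1)} {M' : Fin (d + 1) → ℕ}

/-- [folklore] **`C · C′ = 1`** with `C = fromBlocks 1 0 E 1`, `C′ = fromBlocks 1 0 (−E) 1`. -/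
theorem evalC_mul_inv : evalC N N₂ ρ ρ₂ M' * Matrix.fromBlocks 1 0 (-evalE N N₂ ρ ρ₂ M') 1 = 1 := by
  rw [evalC, Matrix.fromBlocks_multiply]
  simp only [Matrix.mul_one, Matrix.one_mul, Matrix.mul_zero, Matrix.zero_mul, add_zero, zero_add, Matrix.mul_neg, add_neg_cancel,
    neg_zero, Matrix.fromBlocks_one]

/-- [folklore] **THE INVERSE OF THE UNIPOTENT EVALUATION MATRIX**: `C⁻¹ = fromBlocks 1 0 (−E) 1`. -/
theorem inv_evalC : (evalC N N₂ ρ ρ₂ M')⁻¹ = Matrix.fromBlocks 1 0 (-evalE N N₂ ρ ρ₂ M') 1 :=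
  Matrix.inv_eq_right_inv evalC_mul_inv

variable [∀ μ, NeZero (M' μ)] [NeZero N]

/-- [folklore] **THE ONE-SHOT FP OPERATOR OF THE TORUS CALL FACTORS THROUGH THE BIG COMB's OWN BASIS**: with `P` the big comb rows re-indexed by `resBigEquiv`
on the field slots and `[D₂|D₁]` the packed generators on the field slots (the OWNER's `hP hD₂ hD₁`),
`P·[D₂|D₁] = (combRowsT″ · tgrad″↾Res″)∘(e.symm, e.symm) · C`. -/
theorem bigComb_PW0_eq (hN : 0 < N) (hρ : ∀ i, 0 ≤ ρ i ∧ ρ i < N) (hN₂ : 0 < N₂) (hρ₂ : ∀ i, 0 ≤ ρ₂ i ∧ ρ₂ i < N₂) (hM' : ∀ i, N₂ ∣ M' i) :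
    ((combRowsT ((N : ℤ) • ρ₂ + ρ) (N * N₂) (fine N M')).submatrix (resBigEquiv N N₂ ρ ρ₂ M' hN hρ hN₂ hρ₂).symm
          (fun b : ↥(pbox (fine N M')) × Fin (d + 1) => ((b.1, Sum.inl b.2) : Idx (fine N M') (Fib d))))
        * Matrix.fromCols
            ((tgradBlock M' N).submatrix (fun b : ↥(pbox (fine N M')) × Fin (d + 1) => ((b.1, Sum.inl b.2) : Idx (fine N M') (Fib d)))
              (fun t : Res ρ₂ N₂ M' => t.1))
            ((tgrad (fine N M')).submatrix (fun b : ↥(pbox (fine N M')) × Fin (d + 1) => ((b.1, Sum.inl b.2) : Idx (fine N M') (Fib d)))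
              (fun s : Res ρ N (fine N M') => s.1))
      = (combRowsT ((N : ℤ) • ρ₂ + ρ) (N * N₂) (fine N M')
            * (tgrad (fine N M')).submatrix id (fun s : Res ((N : ℤ) • ρ₂ + ρ) (N * N₂) (fine N M') => s.1)).submatrix
          (resBigEquiv N N₂ ρ ρ₂ M' hN hρ hN₂ hρ₂).symm (resBigEquiv N N₂ ρ ρ₂ M' hN hρ hN₂ hρ₂).symm
        * evalC N N₂ ρ ρ₂ M' := by
  have h : (combRowsT ((N : ℤ) • ρ₂ + ρ) (N * N₂) (fine N M')).submatrix (resBigEquiv N N₂ ρ ρ₂ M' hN hρ hN₂ hρ₂).symm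
          (fun b : ↥(pbox (fine N M')) × Fin (d + 1) => ((b.1, Sum.inl b.2) : Idx (fine N M') (Fib d)))
        * (Matrix.fromCols ((tgradBlock M' N).submatrix id fun t : Res ρ₂ N₂ M' => t.1)
            ((tgrad (fine N M')).submatrix id fun s : Res ρ N (fine N M') => s.1)).submatrix
            (fun b : ↥(pbox (fine N M')) × Fin (d + 1) => ((b.1, Sum.inl b.2) : Idx (fine N M') (Fib d))) id
      = (combRowsT ((N : ℤ) • ρ₂ + ρ) (N * N₂) (fine N M')
            * (tgrad (fine N M')).submatrix id (fun s : Res ((N : ℤ) • ρ₂ + ρ) (N * N₂) (fine N M') => s.1)).submatrix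
          (resBigEquiv N N₂ ρ ρ₂ M' hN hρ hN₂ hρ₂).symm (resBigEquiv N N₂ ρ ρ₂ M' hN hρ hN₂ hρ₂).symm
        * evalC N N₂ ρ ρ₂ M' := by
    rw [combRowsT_fieldSlot_mul (Nat.mul_pos hN hN₂) (bigRoot_bounds hN hρ hρ₂) (fine_dvd hM'), W0_eq hN hρ hN₂ hρ₂, ← Matrix.mul_assoc,
      submatrix_mul_submatrix]
  rw [← fromCols_submatrix_fieldSlot] at h
  exact h

open Classical in
/-- [folklore] **THE INVERSE OF THE ONE-SHOT FP OPERATOR OF THE TORUS CALL**: `(P·[D₂|D₁])⁻¹ = fromBlocks 1 0 (−E) 1 · (T″⁻¹)∘(e.symm, e.symm)` with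
`T″⁻¹ y x = signOf″ x · [x is a big-comb-ancestor-or-self of y]` (§2). -/
theorem inv_bigComb_PW0 (hN : 0 < N) (hρ : ∀ i, 0 ≤ ρ i ∧ ρ i < N) (hN₂ : 0 < N₂) (hρ₂ : ∀ i, 0 ≤ ρ₂ i ∧ ρ₂ i < N₂) (hM' : ∀ i, N₂ ∣ M' i) :
    (((combRowsT ((N : ℤ) • ρ₂ + ρ) (N * N₂) (fine N M')).submatrix (resBigEquiv N N₂ ρ ρ₂ M' hN hρ hN₂ hρ₂).symm
          (fun b : ↥(pbox (fine N M')) × Fin (d + 1) => ((b.1, Sum.inl b.2) : Idx (fine N M') (Fib d))))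
        * Matrix.fromCols
            ((tgradBlock M' N).submatrix (fun b : ↥(pbox (fine N M')) × Fin (d + 1) => ((b.1, Sum.inl b.2) : Idx (fine N M') (Fib d)))
              (fun t : Res ρ₂ N₂ M' => t.1))
            ((tgrad (fine N M')).submatrix (fun b : ↥(pbox (fine N M')) × Fin (d + 1) => ((b.1, Sum.inl b.2) : Idx (fine N M') (Fib d)))
              (fun s : Res ρ N (fine N M') => s.1)))⁻¹
      = Matrix.fromBlocks 1 0 (-evalE N N₂ ρ ρ₂ M') 1
        * (Matrix.of fun y x : Res ((N : ℤ) • ρ₂ + ρ) (N * N₂) (fine N M') =>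
            ((signOf ((N : ℤ) • ρ₂ + ρ) (N * N₂) x.site : ℤ) : ℝ)
              * (if Relation.ReflTransGen (fun a b => parentT ((N : ℤ) • ρ₂ + ρ) (N * N₂) (fine N M') a = some b) y x then 1 else 0)).submatrix
          (resBigEquiv N N₂ ρ ρ₂ M' hN hρ hN₂ hρ₂).symm (resBigEquiv N N₂ ρ ρ₂ M' hN hρ hN₂ hρ₂).symm := by
  rw [bigComb_PW0_eq hN hρ hN₂ hρ₂ hM', Matrix.mul_inv_rev, inv_evalC, Matrix.inv_submatrix_equiv,
    inv_combRowsT_mul_tgrad (Nat.mul_pos hN hN₂) (bigRoot_bounds hN hρ hρ₂) (fine_dvd hM')]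

open Classical in
/-- [folklore] **COLUMN `e x` OF `(P·[D₂|D₁])⁻¹`, BLOCK ROWS**: on a coarse residual parameter `t̄` it reads the big-comb ancestor indicator at the SMALL ROOT
`e.symm (inl t̄)` (site `N•t̄ + ρ`) of the block. -/
theorem inv_bigComb_PW0_apply_inl (hN : 0 < N) (hρ : ∀ i, 0 ≤ ρ i ∧ ρ i < N) (hN₂ : 0 < N₂) (hρ₂ : ∀ i, 0 ≤ ρ₂ i ∧ ρ₂ i < N₂) (hM' : ∀ i, N₂ ∣ M' i)
    (t : Res ρ₂ N₂ M') (x : Res ((N : ℤ) • ρ₂ + ρ) (N * N₂) (fine N M')) :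
    (((combRowsT ((N : ℤ) • ρ₂ + ρ) (N * N₂) (fine N M')).submatrix (resBigEquiv N N₂ ρ ρ₂ M' hN hρ hN₂ hρ₂).symm
          (fun b : ↥(pbox (fine N M')) × Fin (d + 1) => ((b.1, Sum.inl b.2) : Idx (fine N M') (Fib d))))
        * Matrix.fromCols
            ((tgradBlock M' N).submatrix (fun b : ↥(pbox (fine N M')) × Fin (d + 1) => ((b.1, Sum.inl b.2) : Idx (fine N M') (Fib d)))
              (fun t : Res ρ₂ N₂ M' => t.1))
            ((tgrad (fine N M')).submatrix (fun b : ↥(pbox (fine N M')) × Fin (d + 1) => ((b.1, Sum.inl b.2) : Idx (fine N M') (Fib d)))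
              (fun s : Res ρ N (fine N M') => s.1)))⁻¹ (Sum.inl t) (resBigEquiv N N₂ ρ ρ₂ M' hN hρ hN₂ hρ₂ x)
      = ((signOf ((N : ℤ) • ρ₂ + ρ) (N * N₂) x.site : ℤ) : ℝ)
        * (if Relation.ReflTransGen (fun a b => parentT ((N : ℤ) • ρ₂ + ρ) (N * N₂) (fine N M') a = some b)
              ((resBigEquiv N N₂ ρ ρ₂ M' hN hρ hN₂ hρ₂).symm (Sum.inl t)) x then 1 else 0) := by
  rw [inv_bigComb_PW0 hN hρ hN₂ hρ₂ hM', Matrix.mul_apply, Fintype.sum_sum_type]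
  simp only [Matrix.fromBlocks_apply₁₁, Matrix.fromBlocks_apply₁₂, Matrix.one_apply, Matrix.zero_apply, zero_mul, Finset.sum_const_zero, add_zero,
    ite_mul, one_mul, Finset.sum_ite_eq, Finset.mem_univ, if_true, Matrix.submatrix_apply, Matrix.of_apply, Equiv.symm_apply_apply]

open Classical in
/-- [folklore] **COLUMN `e x` OF `(P·[D₂|D₁])⁻¹`, FINE-RESIDUAL ROWS**: on a small non-root `s` it reads the big-comb ancestor indicator at `s` MINUS the one at
the small root of the block of `s` (the unipotent correction `−E`). -/
theorem inv_bigComb_PW0_apply_inr (hN : 0 < N) (hρ : ∀ i, 0 ≤ ρ i ∧ ρ i < N) (hN₂ : 0 < N₂) (hρ₂ : ∀ i, 0 ≤ ρ₂ i ∧ ρ₂ i < N₂) (hM' : ∀ i, N₂ ∣ M' i)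
    (s : Res ρ N (fine N M')) (x : Res ((N : ℤ) • ρ₂ + ρ) (N * N₂) (fine N M')) :
    (((combRowsT ((N : ℤ) • ρ₂ + ρ) (N * N₂) (fine N M')).submatrix (resBigEquiv N N₂ ρ ρ₂ M' hN hρ hN₂ hρ₂).symm
          (fun b : ↥(pbox (fine N M')) × Fin (d + 1) => ((b.1, Sum.inl b.2) : Idx (fine N M') (Fib d))))
        * Matrix.fromCols
            ((tgradBlock M' N).submatrix (fun b : ↥(pbox (fine N M')) × Fin (d + 1) => ((b.1, Sum.inl b.2) : Idx (fine N M') (Fib d)))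
              (fun t : Res ρ₂ N₂ M' => t.1))
            ((tgrad (fine N M')).submatrix (fun b : ↥(pbox (fine N M')) × Fin (d + 1) => ((b.1, Sum.inl b.2) : Idx (fine N M') (Fib d)))
              (fun s : Res ρ N (fine N M') => s.1)))⁻¹ (Sum.inr s) (resBigEquiv N N₂ ρ ρ₂ M' hN hρ hN₂ hρ₂ x)
      = ((signOf ((N : ℤ) • ρ₂ + ρ) (N * N₂) x.site : ℤ) : ℝ)
          * (if Relation.ReflTransGen (fun a b => parentT ((N : ℤ) • ρ₂ + ρ) (N * N₂) (fine N M') a = some b)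
                ((resBigEquiv N N₂ ρ ρ₂ M' hN hρ hN₂ hρ₂).symm (Sum.inr s)) x then 1 else 0)
        - ∑ t : Res ρ₂ N₂ M', evalE N N₂ ρ ρ₂ M' s t
            * (((signOf ((N : ℤ) • ρ₂ + ρ) (N * N₂) x.site : ℤ) : ℝ)
              * (if Relation.ReflTransGen (fun a b => parentT ((N : ℤ) • ρ₂ + ρ) (N * N₂) (fine N M') a = some b)
                    ((resBigEquiv N N₂ ρ ρ₂ M' hN hρ hN₂ hρ₂).symm (Sum.inl t)) x then 1 else 0)) := by
  rw [inv_bigComb_PW0 hN hρ hN₂ hρ₂ hM', Matrix.mul_apply, Fintype.sum_sum_type]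
  simp only [Matrix.fromBlocks_apply₂₁, Matrix.fromBlocks_apply₂₂, Matrix.one_apply, Matrix.neg_apply, neg_mul, Finset.sum_neg_distrib,
    ite_mul, one_mul, zero_mul, Finset.sum_ite_eq, Finset.mem_univ, if_true, Matrix.submatrix_apply, Matrix.of_apply, Equiv.symm_apply_apply]
  ring

end Torus

end Summit.QuantumFields.BalabanUV.Beta.FP.CombSlicePathInverse

end
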